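import Summits.ValiantsHypothesis.ValiantsHypothesis.Theorems.DefinabilityGapNumerics
import Summits.ValiantsHypothesis.ValiantsHypothesis.Theorems.DefinabilityGapPhaseABad
import Summits.ValiantsHypothesis.ValiantsHypothesis.Theorems.DefinabilityGapMovers
import Summits.ValiantsHypothesis.ValiantsHypothesis.Theorems.DefinabilityGapBlockedRows
import HarnessLib

/-!
# Definability gap, ROAD P: the ROUND-ONE state exists (N1 v2 §(5), PLAN (d) v2)

For all large `m`, every family `T` with `#T ≤ 2q+1` and every pivot column `s₀` of small
total column load (`exists_pivotColumn`), some ADMISSIBLE row assignment `r` is simultaneously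

* off the Phase-A bad set for the schedule with the GROWING free-position demand
  `B₁ = ⌊47 θ₀ s/256⌋` (so clauses 2–3 hold with `Θ(θ₀² m)` free positions to spare);
* has fewer than `K = 2 p² · 2#T(#T−1)/m + 1 = O(m)` pivot collisions (Markov at `1/2`);
* gives every non-hub curve (`colLoad ≤ Λ₀ = 3m²/32`) fewer than `p Λ₀ + m/8 ≤ 5m/16` blocked
  rows (Bernstein), i.e. `≥ 0.43 m` admissible rows with the pivot column free to re-pick from.

Main: **`exists_roundOne`**.  Ingredients: `exists_adm_not_mem_union` (PhaseABad) with the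
extra event `{K ≤ collCount} ∪ {∃ non-hub with many blocked rows}`, `weight_manyCollisions_le`
(Movers), `weight_exists_manyBlocked_le` (BlockedRows), and the numerics of this file
(`hB_B₁`, `smallExpr_eventually_lt`, `blocked_eventually`).
-/

namespace Summit.ValiantsHypothesis.ValiantsHypothesis.Theorems.DefinabilityGapRoundOne

open Filter Topology Real Finset Literature.Probability.Moments
open Literature.Computability.AlgebraicComplexity Literature.Computability.MetaComplexity
open Summit.ValiantsHypothesis.ValiantsHypothesis.Theorems.DefinabilityGapAffineRung
open Summit.ValiantsHypothesis.ValiantsHypothesis.Theorems.DefinabilityGapPivotCertificate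
open Summit.ValiantsHypothesis.ValiantsHypothesis.Theorems.DefinabilityGapPivotAdmissible
open Summit.ValiantsHypothesis.ValiantsHypothesis.Theorems.DefinabilityGapPivotPhaseA
open Summit.ValiantsHypothesis.ValiantsHypothesis.Theorems.DefinabilityGapCrowdedFree
open Summit.ValiantsHypothesis.ValiantsHypothesis.Theorems.DefinabilityGapPivotColumn
open Summit.ValiantsHypothesis.ValiantsHypothesis.Theorems.DefinabilityGapAsymptotics
open Summit.ValiantsHypothesis.ValiantsHypothesis.Theorems.DefinabilityGapNumerics
open Summit.ValiantsHypothesis.ValiantsHypothesis.Theorems.DefinabilityGapPhaseAExists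
open Summit.ValiantsHypothesis.ValiantsHypothesis.Theorems.DefinabilityGapPhaseABad
open Summit.ValiantsHypothesis.ValiantsHypothesis.Theorems.DefinabilityGapMovers
open Summit.ValiantsHypothesis.ValiantsHypothesis.Theorems.DefinabilityGapBlockedRows

/-! ## 1. The growing free-position demand `B₁` -/

/-- `B₁ = ⌊47 θ₀ s / 256⌋`, half of the free positions `hB_eventually` guarantees. [this file] -/
noncomputable def B₁ (m : ℕ) : ℕ := ⌊θ₀ * (sC m : ℝ) * 47 / 256⌋₊

/-- `B₁ ≤ 47 θ₀ s/256`. [this file] -/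
theorem B₁_real_le (m : ℕ) : (B₁ m : ℝ) ≤ θ₀ * (sC m : ℝ) * 47 / 256 :=
  Nat.floor_le (by have := theta0_pos; positivity)

/-- `B₁ ≥ 47 θ₀ s/256 − 1`. [this file] -/
theorem B₁_real_ge (m : ℕ) : θ₀ * (sC m : ℝ) * 47 / 256 - 1 ≤ (B₁ m : ℝ) :=
  (Nat.sub_one_lt_floor _).le

/-- `B₁ ≤ s`. [this file] -/
theorem B₁_le_sC (m : ℕ) : B₁ m ≤ sC m := by
  have h1 := B₁_real_le m
  have h2 : θ₀ * (sC m : ℝ) * 47 / 256 ≤ sC m := by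
    have := theta0_le_one; have := theta0_pos
    have h0 : (0 : ℝ) ≤ sC m := Nat.cast_nonneg _
    nlinarith
  exact_mod_cast h1.trans h2

/-- `B₁ → ∞`. [this file] -/
theorem tendsto_B₁ : Tendsto (fun m : ℕ => (B₁ m : ℝ)) atTop atTop := by
  have hc : 0 < θ₀ * 47 / 256 := by have := theta0_pos; positivity
  have hg : Tendsto (fun m : ℕ => θ₀ * 47 / 256 * (sC m : ℝ) + -1) atTop atTop :=
    tendsto_atTop_add_const_right atTop _ (tendsto_sC.const_mul_atTop hc)
  refine tendsto_atTop_mono (fun m => ?_) hg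
  have := B₁_real_ge m
  linarith

/-- Eventually `2400 ≤ B₁`. [this file] -/
theorem eventually_BC_le_B₁ : ∀ᶠ m : ℕ in atTop, BC ≤ B₁ m := by
  filter_upwards [tendsto_B₁.eventually_ge_atTop ((BC : ℕ) : ℝ)] with m hm
  exact_mod_cast hm

/-- `n₀ + B₁ ≤ m + 1`. [this file] -/
theorem hn₀_B₁ (m : ℕ) : m / 2 + B₁ m ≤ m + 1 := by
  have h1 := B₁_le_sC m
  have h2 := sC_le m
  omega

/-- Eventually `2 (2q+1) ≤ M L B₁`. [this file] -/
theorem hMLB_B₁ : ∀ᶠ m : ℕ in atTop, 2 * (2 * qOf m + 1) ≤ MC m * LC m * B₁ m := by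
  filter_upwards [eventually_ge_atTop 128, eventually_BC_le_B₁] with m hm hB
  exact (hMLB_holds hm).trans (Nat.mul_le_mul_left _ hB)

/-- THE FREE-POSITION THRESHOLD for `B₁` (for `m ≥ 4`):
`B₁ ≤ e^{−2pN} s/2 − 2(4pNs²/n₀ + t')`. [this file] -/
theorem hB_B₁ {m : ℕ} (hm : 4 ≤ m) : (B₁ m : ℝ) ≤
    exp (-(2 * pC m * NC m)) * sC m / 2 -
      2 * (4 * pC m * NC m * (sC m : ℝ) ^ 2 / ((m / 2 : ℕ) : ℝ) + tpC m) := by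
  have hθ := theta0_le hm
  have hσ := sigma_le hm
  have hs0 : (0 : ℝ) ≤ sC m := Nat.cast_nonneg _
  have h1 : θ₀ * sC m / 2 ≤ exp (-(2 * pC m * NC m)) * sC m / 2 := by
    have := mul_le_mul_of_nonneg_right hθ hs0
    linarith
  have hB := B₁_real_le m
  have := theta0_pos
  unfold tpC
  nlinarith

/-! ## 2. The Phase-A terms below any `ε` -/

/-- The four Phase-A union bounds are eventually `< ε`, for every `ε > 0`. [this file] -/
theorem smallExpr_eventually_lt {ε : ℝ} (hε : 0 < ε) : ∀ᶠ m : ℕ in atTop, ∀ Tc : ℝ, 0 ≤ Tc →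
    Tc ≤ 4 * (m : ℝ) ^ 2 + 5 → smallExpr m Tc < ε := by
  have ha1 : (0 : ℝ) < 3 / 256 := by norm_num
  have ha2 : 0 < θ₀ / 13 * (θ₀ / 131072) := by have := theta0_pos; positivity
  have hε2 : 0 < ε / 2 := by positivity
  filter_upwards [eventually_ge_atTop 24, eventually_two_le_sC,
    eventually_const_mul_pow_mul_exp_neg_lt 3 ha1 10 hε2,
    eventually_const_mul_pow_mul_exp_sub_lt 3 ha2 20 (θ₀ / 13 * (θ₀ / 65536 + 1)) hε2]
    with m hm hs hE1 hE2 Tc hT0 hT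
  have hm3 : (3 : ℝ) ≤ m := by exact_mod_cast (show 3 ≤ m by omega)
  have hT5 : Tc ≤ 5 * (m : ℝ) ^ 2 := by nlinarith
  have hle := smallExpr_le hm (by omega) hT0 hT5
  have hD : 20 * (m : ℝ) ^ 3 * exp (-(θ₀ / 13 * sC m)) ≤
      20 * (m : ℝ) ^ 3 * exp (θ₀ / 13 * (θ₀ / 65536 + 1) - θ₀ / 13 * (θ₀ / 131072) * m) := by
    gcongr
    have h := sC_ge_linear m
    have hθ : 0 ≤ θ₀ / 13 := by have := theta0_pos; positivity
    have := mul_le_mul_of_nonneg_left h hθ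
    linarith
  linarith

/-! ## 3. The numerics of the two round-one events -/

/-- The hub threshold `Λ₀ = 3m²/32`. [this file] -/
noncomputable def Λ₀ (m : ℕ) : ℝ := 3 * (m : ℝ) ^ 2 / 32

/-- `Λ₀ > 0` for `m ≥ 1`. [this file] -/
theorem Λ₀_pos {m : ℕ} (hm : 1 ≤ m) : 0 < Λ₀ m := by
  unfold Λ₀; have : (0 : ℝ) < m := by exact_mod_cast hm
  positivity

/-- `p Λ₀ ≤ 3m/16`. [this file] -/
theorem pC_mul_Λ₀_le {m : ℕ} (hm : 4 ≤ m) : pC m * Λ₀ m ≤ 3 * (m : ℝ) / 16 := by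
  have hm0 : (0 : ℝ) < m := by exact_mod_cast (show 0 < m by omega)
  calc pC m * Λ₀ m ≤ 2 / m * Λ₀ m :=
        mul_le_mul_of_nonneg_right (pC_le hm) (Λ₀_pos (by omega)).le
    _ = 3 * (m : ℝ) / 16 := by unfold Λ₀; field_simp; ring

/-- The blocked-rows exponent: `exp(−(m/8)²/(2(pΛ₀ + (m/8)/3))) ≤ e^{−3m/88}`. [this file] -/
theorem blocked_exp_le {m : ℕ} (hm : 4 ≤ m) :
    exp (-(((m : ℝ) / 8) ^ 2 / (2 * (pC m * Λ₀ m + 1 * ((m : ℝ) / 8) / 3)))) ≤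
      exp (-(3 / 88 * (m : ℝ))) := by
  have hm0 : (0 : ℝ) < m := by exact_mod_cast (show 0 < m by omega)
  have hX0 : 0 ≤ pC m * Λ₀ m := mul_nonneg (pC_pos (by omega)).le (Λ₀_pos (by omega)).le
  have hX := pC_mul_Λ₀_le hm
  refine exp_le_exp.mpr (neg_le_neg ?_)
  rw [le_div_iff₀ (by positivity)]
  nlinarith [mul_nonneg hm0.le (sub_nonneg.mpr hX)]

/-- Eventually `(4m² + 5) e^{−3m/88} < 1/8`. [this file] -/
theorem blocked_eventually : ∀ᶠ m : ℕ in atTop,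
    (4 * (m : ℝ) ^ 2 + 5) * exp (-(3 / 88 * (m : ℝ))) < 1 / 8 := by
  have ha : (0 : ℝ) < 3 / 88 := by norm_num
  filter_upwards [eventually_ge_atTop 3,
    eventually_const_mul_pow_mul_exp_neg_lt 2 ha 5 (show (0 : ℝ) < 1 / 8 by norm_num)]
    with m hm hE
  have hm3 : (3 : ℝ) ≤ m := by exact_mod_cast hm
  have h5 : 4 * (m : ℝ) ^ 2 + 5 ≤ 5 * (m : ℝ) ^ 2 := by nlinarith
  have := mul_le_mul_of_nonneg_right h5 (exp_pos (-(3 / 88 * (m : ℝ)))).le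
  linarith

/-- Markov's ratio: `Q/(2Q + 1) ≤ 1/2` for `Q ≥ 0`. [this file] -/
theorem div_two_mul_add_one_le {Q : ℝ} (hQ : 0 ≤ Q) : Q / (2 * Q + 1) ≤ 1 / 2 := by
  rw [div_le_iff₀ (by positivity)]
  linarith

/-! ## 4. Round one -/

open scoped Classical in
/-- **THE ROUND-ONE STATE EXISTS.**  For all large `m`, every `T` with `#T ≤ 2q+1` and every
pivot column `s₀` with `m Λ(s₀) ≤ 2#T(#T−1)`, some row assignment obeys the row rule
(`N = 32m`), lies off the Phase-A bad set with the growing demand `B₁`, has fewer than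
`2p²·2#T(#T−1)/m + 1` collisions, and gives every non-hub fewer than `pΛ₀ + m/8` blocked rows.
[this file] -/
theorem exists_roundOne : ∃ m₀ : ℕ, ∀ m : ℕ, m₀ ≤ m →
    ∀ T : Finset (Fin 3 → Fin (qOf m)), T.card ≤ 2 * qOf m + 1 → ∀ s₀ : Fin m,
      m * ∑ c ∈ T, colLoad T c s₀ ≤ 2 * (T.card * (T.card - 1)) →
      ∃ r : (Fin 3 → Fin (qOf m)) → Fin m,
        (∀ c, r c ∉ heavyRows T c (NC m)) ∧
        r ∉ phaseABad T (MC m) (NC m) (m / 2) (pC m) (tC m) (B₁ m : ℝ) ∧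
        ((collCount T s₀ r : ℕ) : ℝ) <
          2 * (pC m ^ 2 * (2 * ((T.card : ℝ) * (T.card - 1 : ℕ)) / m)) + 1 ∧
        ∀ c ∈ T, (colLoad T c s₀ : ℝ) ≤ Λ₀ m →
          ((blockedRows T c r s₀).card : ℝ) < pC m * Λ₀ m + (m : ℝ) / 8 := by
  obtain ⟨m₀, hm₀⟩ := Filter.eventually_atTop.mp
    ((eventually_ge_atTop 4800).and (eventually_two_le_sC.and
      ((smallExpr_eventually_lt (show (0 : ℝ) < 1 / 4 by norm_num)).and blocked_eventually)))
  refine ⟨m₀, fun m hm T hT s₀ hs₀ => ?_⟩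
  obtain ⟨hm4800, hs, hsmall, hblk⟩ := hm₀ m hm
  have hm0 : 0 < m := by omega
  have hm0' : (0 : ℝ) < m := by exact_mod_cast hm0
  have hT2 : 2 * T.card ≤ 2 * (2 * qOf m + 1) := by omega
  have hTc : (T.card : ℝ) ≤ 4 * (m : ℝ) ^ 2 + 5 := by
    have h := card_bound m
    have : ((2 * T.card : ℕ) : ℝ) ≤ ((8 * (m * m) + 10 : ℕ) : ℝ) := by exact_mod_cast hT2.trans h
    push_cast at this
    nlinarith
  have hk : 2 * T.card ≤ NC m * kC m := hT2.trans (hk_holds (by omega))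
  have hkm : kC m < m := kC_lt (by omega)
  -- the admissible sets and their weights
  set A : (Fin 3 → Fin (qOf m)) → Finset (Fin m) := fun c => (heavyRows T c (NC m))ᶜ with hAdef
  have hcardA : ∀ c, m - kC m ≤ (A c).card := fun c =>
    le_card_compl_heavyRows T c hk (by unfold NC; omega)
  have hA : ∀ c, (A c).Nonempty := fun c => Finset.card_pos.mp (by have := hcardA c; omega)
  have hp0 : 0 < pC m := pC_pos (by omega)
  have hAp : ∀ c, 1 / ((A c).card : ℝ) ≤ pC m := fun c => by
    unfold pC
    exact one_div_le_one_div_of_le (by exact_mod_cast (show 0 < m - kC m by omega))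
      (by exact_mod_cast hcardA c)
  have hw : ∀ c a, 0 ≤ admWeight A c a := admWeight_nonneg A
  have hw1 : ∀ c, ∑ a, admWeight A c a = 1 := sum_admWeight A hA
  have hwp : ∀ c a, admWeight A c a ≤ pC m := fun c a => (admWeight_le A c a).trans (hAp c)
  have hwp' : ∀ c, admWeight A c ≤ fun _ => pC m := fun c a => hwp c a
  -- the two extra events
  set Q : ℝ := pC m ^ 2 * (2 * ((T.card : ℝ) * (T.card - 1 : ℕ)) / m) with hQ
  have hQ0 : 0 ≤ Q := by rw [hQ]; positivity
  set E₁ := (Finset.univ : Finset ((Fin 3 → Fin (qOf m)) → Fin m)).filter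
    (fun r => 2 * Q + 1 ≤ ((collCount T s₀ r : ℕ) : ℝ)) with hE₁
  set E₂ := (Finset.univ : Finset ((Fin 3 → Fin (qOf m)) → Fin m)).filter
    (fun r => ∃ c ∈ T, (colLoad T c s₀ : ℝ) ≤ Λ₀ m ∧
      pC m * Λ₀ m + (m : ℝ) / 8 ≤ ((blockedRows T c r s₀).card : ℝ)) with hE₂
  have hW₁ : ∑ r ∈ E₁, prodWeight (admWeight A) r ≤ 1 / 2 := by
    have h := weight_manyCollisions_le hw hw1 hwp T s₀ (show (0 : ℝ) < 2 * Q + 1 by positivity)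
    have hload := sq_mul_load_le (p := pC m) T hm0 hs₀
    calc _ ≤ pC m ^ 2 * (∑ c ∈ T, (colLoad T c s₀ : ℝ)) / (2 * Q + 1) := h
      _ ≤ Q / (2 * Q + 1) := div_le_div_of_nonneg_right hload (by positivity)
      _ ≤ 1 / 2 := div_two_mul_add_one_le hQ0
  have hW₂ : ∑ r ∈ E₂, prodWeight (admWeight A) r ≤ 1 / 8 := by
    have ht : (0 : ℝ) < (m : ℝ) / 8 := by positivity
    have h := weight_exists_manyBlocked_le hw hw1 hp0 hwp' T s₀ (Λ₀_pos (m := m) (by omega)) ht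
    have he := blocked_exp_le (m := m) (by omega)
    have hT0 : (0 : ℝ) ≤ T.card := Nat.cast_nonneg _
    calc _ ≤ (T.card : ℝ) * exp (-(((m : ℝ) / 8) ^ 2 /
            (2 * (pC m * Λ₀ m + 1 * ((m : ℝ) / 8) / 3)))) := h
      _ ≤ (4 * (m : ℝ) ^ 2 + 5) * exp (-(3 / 88 * (m : ℝ))) :=
          mul_le_mul hTc he (exp_pos _).le (by positivity)
      _ ≤ 1 / 8 := hblk.le
  have hE : ∑ r ∈ E₁ ∪ E₂, prodWeight (admWeight A) r ≤ 1 / 2 + 1 / 8 :=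
    (weight_union_le E₁ E₂ (prodWeight_nonneg hw)).trans (add_le_add hW₁ hW₂)
  have hsm := hsmall T.card (Nat.cast_nonneg _) hTc
  unfold smallExpr at hsm
  obtain ⟨r, hr, hrE, hadm⟩ := exists_adm_not_mem_union T A hA hp0
    (pC_le_half (m := m) (by omega)) hAp (MC_pos (m := m) (by omega)) hm0
    (tC_pos (m := m) (by omega)) (N := NC m) (by unfold NC; omega) hs (sC_le m)
    (tpC_pos (m := m) (by omega)) (hB_B₁ (m := m) (by omega)) (E₁ ∪ E₂) (by linarith)
  refine ⟨r, fun c => ?_, hr, ?_, ?_⟩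
  · have := hadm c
    rw [hAdef] at this
    exact Finset.mem_compl.mp this
  · by_contra hge
    exact hrE (Finset.mem_union_left _
      (Finset.mem_filter.mpr ⟨Finset.mem_univ _, not_lt.mp hge⟩))
  · intro c hc hcL
    by_contra hge
    exact hrE (Finset.mem_union_right _
      (Finset.mem_filter.mpr ⟨Finset.mem_univ _, c, hc, hcL, not_lt.mp hge⟩))

end Summit.ValiantsHypothesis.ValiantsHypothesis.Theorems.DefinabilityGapRoundOne
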